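import Mathlib.MeasureTheory.Integral.IntegralEqImproper
import Mathlib.Data.Real.Pointwise

/-!
# The Eliashberg member of a `T_c` band: exact similarity under a rescaling of the phonon frequencies

Companion to `EliashbergTcMonotonicity` (`μ*`), `EliashbergTcCouplingMonotonicity` (coupling scale `f`)
and `EliashbergIsotropicCompression`. The conventional-branch pipelines (`pub/hubbard-eph`) carry
stated-assumption boxes that rescale all phonon frequencies of a material's Eliashberg function by a
factor `g ∈ [g₋, g₊]` at fixed `λ` (`omegalog_factor` boxes, e.g. spin–orbit softening) and evaluate the
linearised isotropic Migdal–Eliashberg `T_c` at the two corners only. The corner rule here is an EXACT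
SIMILARITY: with `α²F_g(ω) = α²F(ω/g)` every Matsubara coupling satisfies
`λ_g(ν; T) = λ(ν; T/g)` [cite: AllenDynes1975, Eqs. (9)–(12): `λ(n) = 2∫ dω ω α²F(ω)/(ω² + (2πnT)²)`],
so any gap-equation eigenvalue that depends on temperature only through the couplings
`(λ(2πTj; T))_j` and the reduced temperature `T/ω_max` (the cutoff count `N ≈ k ω_max/(2πT)` and the
cutoff pseudopotential are functions of `T/ω_max`) takes the same values at `(α²F_g, T)` as at
`(α²F, T/g)`: the super-level set `{T > 0 | 1 ≤ ρ}` is multiplied by `g` and `T_c ↦ g · T_c` — in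
particular `T_c` is monotone in `g`, which is the corner rule.

Proved here (change of variables + order theory; the solver `ρ` is an ARBITRARY function of the
reduced temperature and the coupling sequence, so the statement covers every imaginary-axis
discretisation in use — Toeplitz or Toeplitz-plus-Hankel kernels, any cutoff multiple `k`, any
`μ*` convention referred to `ω_max`):
* `matsubaraCoupling` — `λ(ν; T) = ∫_{ω>0} α²F(ω) · 2ω/(ω² + (2πTν)²) dω`;
* `matsubaraCoupling_freqScaled` — `λ[α²F(·/g)](ν; T) = λ[α²F](ν; T/g)` for `g > 0`;
* `superlevel_freqScaled`, `sSup_superlevel_freqScaled` — the super-level set scales by `g` and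
  `T_c[α²F(·/g)] = g · T_c[α²F]` (threshold form, `sSup`; no boundedness needed).

Deliberately NOT here: the kernels themselves (see the companion files), `μ*` conventions referred
to `ω_log` (they scale the same way since `ω_log ↦ g ω_log`), anisotropic equations.

## References
* [AllenDynes1975] P. B. Allen, R. C. Dynes, Phys. Rev. B 12 (1975) 905 — Eqs. (9)–(12)
  (imaginary-axis linearised equations; definition of `λ(n)`).
* [MarsiglioCarbotte2008] F. Marsiglio, J. P. Carbotte, *Electron–Phonon Superconductivity*,
  Springer 2008 (= arXiv:cond-mat/0106143) — Eqs. (gb1)–(gb4) p. 11, `λ(z)` p. 11.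
-/

noncomputable section

open MeasureTheory Set Real
open scoped Pointwise

namespace Literature.MathematicalPhysics.QuantumManyBody

/-- **Matsubara-axis electron–phonon coupling** `λ(ν; T) = ∫_{ω>0} α²F(ω) · 2ω / (ω² + (2πTν)²) dω`
(`ν = n − m` an integer in the equations; stated for real `ν`). [cite: AllenDynes1975, Eqs. (9)–(12)] -/
def matsubaraCoupling (α2F : ℝ → ℝ) (T ν : ℝ) : ℝ :=
  ∫ ω in Ioi (0 : ℝ), α2F ω * (2 * ω / (ω ^ 2 + (2 * π * T * ν) ^ 2))

/-- **Frequency rescaling is a temperature rescaling of the couplings**: for `g > 0` and the rescaled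
spectrum `α²F_g(ω) = α²F(ω/g)` (all phonon frequencies multiplied by `g`, `λ = λ(0)` unchanged),
`λ_g(ν; T) = λ(ν; T/g)` — the substitution `ω = g u` in the defining integral.
[cite: AllenDynes1975, Eqs. (9)–(12)] -/
theorem matsubaraCoupling_freqScaled (α2F : ℝ → ℝ) {g : ℝ} (hg : 0 < g) (T ν : ℝ) :
    matsubaraCoupling (fun ω => α2F (ω / g)) T ν = matsubaraCoupling α2F (T / g) ν := by
  unfold matsubaraCoupling
  set c : ℝ := 2 * π * T * ν with hc
  -- the substitution ω = g u, i.e. u = g⁻¹ ω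
  let G : ℝ → ℝ := fun u => α2F u * (2 * (g * u) / ((g * u) ^ 2 + c ^ 2))
  have key := MeasureTheory.integral_comp_mul_left_Ioi G 0 (inv_pos.mpr hg)
  rw [mul_zero, inv_inv, smul_eq_mul] at key
  have hgu : ∀ ω : ℝ, g * (g⁻¹ * ω) = ω := fun ω => by field_simp
  calc ∫ ω in Ioi (0 : ℝ), α2F (ω / g) * (2 * ω / (ω ^ 2 + c ^ 2))
      = ∫ ω in Ioi (0 : ℝ), G (g⁻¹ * ω) := by
        refine setIntegral_congr_fun measurableSet_Ioi fun ω _ => ?_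
        simp only [G, hgu, div_eq_inv_mul ω g]
    _ = g * ∫ u in Ioi (0 : ℝ), G u := key
    _ = ∫ u in Ioi (0 : ℝ), g * G u := (integral_const_mul g G).symm
    _ = ∫ u in Ioi (0 : ℝ), α2F u * (2 * u / (u ^ 2 + (2 * π * (T / g) * ν) ^ 2)) := by
        refine setIntegral_congr_fun measurableSet_Ioi fun u hu => ?_
        have hu0 : 0 < u := hu
        have hden : (g * u) ^ 2 + c ^ 2 ≠ 0 := by positivity
        have hcg : 2 * π * (T / g) * ν = c / g := by rw [hc]; field_simp
        have hden' : u ^ 2 + (c / g) ^ 2 ≠ 0 := by positivity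
        simp only [G, hcg]
        field_simp

/-- **The super-level set scales by `g`.** Let `ρ τ Λ` be ANY function of a reduced temperature `τ`
and a sequence of couplings `Λ : ℕ → ℝ` (the top eigenvalue of an imaginary-axis linearised
Eliashberg kernel built from `N(τ)` Matsubara frequencies with cutoff pseudopotential `μ*_N(τ)`,
`τ = T/ω_max`). Then for `g > 0` the temperatures at which the `g`-rescaled problem
(`α²F(·/g)`, `ω_max ↦ g ω_max`) has `ρ ≥ 1` are exactly `g` times those of the original problem.
[cite: AllenDynes1975, Eqs. (9)–(12)] -/
theorem superlevel_freqScaled (ρ : ℝ → (ℕ → ℝ) → ℝ) (α2F : ℝ → ℝ) {g ωmax : ℝ} (hg : 0 < g) :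
    {T : ℝ | 0 < T ∧ 1 ≤ ρ (T / (g * ωmax))
        (fun j : ℕ => matsubaraCoupling (fun ω => α2F (ω / g)) T j)} =
      g • {T : ℝ | 0 < T ∧ 1 ≤ ρ (T / ωmax) (fun j : ℕ => matsubaraCoupling α2F T j)} := by
  ext T
  simp only [mem_setOf_eq, matsubaraCoupling_freqScaled α2F hg]
  rw [Set.mem_smul_set]
  constructor
  · rintro ⟨hT, h1⟩
    refine ⟨T / g, ⟨div_pos hT hg, ?_⟩, by rw [smul_eq_mul]; field_simp⟩
    rw [div_div]
    exact h1
  · rintro ⟨T', ⟨hT', h1⟩, rfl⟩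
    rw [smul_eq_mul]
    refine ⟨mul_pos hg hT', ?_⟩
    have e1 : g * T' / (g * ωmax) = T' / ωmax := by
      rw [mul_div_mul_left _ _ hg.ne']
    have e2 : g * T' / g = T' := by field_simp
    rw [e1, e2]
    exact h1

/-- **`T_c` of the frequency-rescaled problem is `g · T_c`** (threshold form): with `T_c` the supremum
of the positive temperatures at which the linearised-equation eigenvalue reaches `1`,
`T_c[α²F(·/g)] = g · T_c[α²F]` for every `g > 0` and every solver `ρ` of the stated form. Hence the
Eliashberg member of a band is monotone in an `omegalog_factor` box and its corners are exact.
(`Real.sSup` conventions: `sSup ∅ = 0` and `sSup` of an unbounded set `= 0` scale consistently.)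
[cite: AllenDynes1975, Eqs. (9)–(12)] -/
theorem sSup_superlevel_freqScaled (ρ : ℝ → (ℕ → ℝ) → ℝ) (α2F : ℝ → ℝ) {g ωmax : ℝ}
    (hg : 0 < g) :
    sSup {T : ℝ | 0 < T ∧ 1 ≤ ρ (T / (g * ωmax))
        (fun j : ℕ => matsubaraCoupling (fun ω => α2F (ω / g)) T j)} =
      g * sSup {T : ℝ | 0 < T ∧ 1 ≤ ρ (T / ωmax) (fun j : ℕ => matsubaraCoupling α2F T j)} := by
  rw [superlevel_freqScaled ρ α2F hg, Real.sSup_smul_of_nonneg hg.le, smul_eq_mul]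

end Literature.MathematicalPhysics.QuantumManyBody

end
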